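import Summits.CriticalPhenomena.CardyFormulaZ2.Theorems.CardyFlipRussoJitteredTriangularLegLower
import Literature.Probability.Percolation.TriHexLemma

/-!
# `JitteredTriangularLeg` at `σ = 0`: the upper sandwich half for the continuum event

Helper file for the support item `JitteredTriangularLeg` (stmt-CriticalPhenomena-6436) of route
`CardyFlipRusso`, continuing `CardyFlipRussoJitteredTriangularLegLower.lean`: the SECOND
event-specific input of Bollobás–Riordan's proof of Smirnov's theorem (*Percolation* (2006), Ch. 7,
Claim 19 second part and Claim 20 p. 192, remark p. 195) for the continuum crossing event
`voronoiCrossing` — a closed `𝕋`-path of `G_δ⁺` type prevents the continuum crossing.  The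
cross-cut of closed mesh edges from `arc 1°` to `arc 3°` is built as in
`TriCrossingSandwich.lean` (`not_mem_triCrossing_compl_of_pathIn`); the blocking step applies
Newman's cross-cut theorem (`JordanDomain.inter_nonempty_of_crosscut`, proved in the tree) to the
black continuum path itself, which misses the cross-cut because the drawing of a mesh edge between
two closed sites is disjoint from the closed black region (`not_mem_blackRegion_of_mem_segment`,
via Stewart's identity).  No corner condition is needed for the continuum event.  Contents: `norm_sq_add_smul_sub`, `three_quarters_sq_le_dist_sq`, `not_mem_blackRegion_of_mem_segment`,
`not_voronoiCrossing_of_pathIn` (deterministic), `real_voronoiCrossing_le_real_not_pathIn` (probability).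

References: B. Bollobás, O. Riordan, *Percolation*, CUP (2006), Ch. 7 §7.2.5, Claims 19–20
p. 192, remark p. 195; M. H. A. Newman, *Elements of the topology of plane sets of points* (1939),
Ch. V §11.
-/

noncomputable section

open MeasureTheory Set Metric
open scoped Pointwise
namespace Summit.CriticalPhenomena.CardyFormulaZ2.Theorems

open Literature.Probability.Percolation Literature.Probability.LatticeModels
  Literature.Probability.RandomPlanarGeometry Literature.Topology.PlaneTopology

/-! ### The upper sandwich half for the continuum event

Bollobás–Riordan 2006, Ch. 7, Claim 19 (second part) p. 192 with the remark p. 195: a crossing of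
the "shorter, fatter" domain `G_δ⁺` by CLOSED sites from `A₂(G_δ⁺)` to `A₄(G_δ⁺)` prevents a
crossing of `D₄` from `A₁` to `A₃` — here for the continuum event (G02 version:
`not_mem_triCrossing_compl_of_pathIn`).  The cross-cut of white mesh edges from `arc 1°` to
`arc 3°` is built exactly as in `TriCrossingSandwich.lean`; the blocking step is Newman's cross-cut
theorem applied to the black continuum path itself, which cannot meet the cross-cut because the
drawing of a mesh edge between two white sites is disjoint from the (closed) black region.  No
corner condition is needed for the continuum event. -/

/-- **Stewart's identity** for the squared distance from a point of a segment:
`|p + θ(q - p) - c|² = (1 - θ)|p - c|² + θ|q - c|² - θ(1 - θ)|p - q|²`. [folklore] -/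
theorem norm_sq_add_smul_sub (p q c : ℂ) (θ : ℝ) :
    ‖p + θ • (q - p) - c‖ ^ 2 =
      (1 - θ) * ‖p - c‖ ^ 2 + θ * ‖q - c‖ ^ 2 - θ * (1 - θ) * ‖p - q‖ ^ 2 := by
  simp only [Complex.sq_norm, Complex.normSq_apply, Complex.real_smul, Complex.sub_re,
    Complex.sub_im, Complex.add_re, Complex.add_im, Complex.mul_re, Complex.mul_im,
    Complex.ofReal_re, Complex.ofReal_im]
  ring

/-- **A mesh edge keeps every third site at distance `≥ (√3/2) δ`**: if `|p - q| = δ` and the point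
`c` is at distance `≥ δ` from both `p` and `q`, then every point of `[p, q]` is at squared
distance `≥ ¾ δ²` from `c`. [folklore] -/
theorem three_quarters_sq_le_dist_sq {p q c : ℂ} {δ : ℝ} (hpq : dist p q = δ) (hp : δ ≤ dist p c)
    (hq : δ ≤ dist q c) {z : ℂ} (hz : z ∈ segment ℝ p q) : 3 / 4 * δ ^ 2 ≤ dist z c ^ 2 := by
  rw [segment_eq_image'] at hz
  obtain ⟨θ, ⟨hθ0, hθ1⟩, rfl⟩ := hz
  have hδ : 0 ≤ δ := hpq ▸ dist_nonneg
  have e := norm_sq_add_smul_sub p q c θ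
  rw [← dist_eq_norm, ← dist_eq_norm, ← dist_eq_norm, ← dist_eq_norm, hpq] at e
  rw [e]
  have h1 : δ ^ 2 ≤ dist p c ^ 2 := pow_le_pow_left₀ hδ hp 2
  have h2 : δ ^ 2 ≤ dist q c ^ 2 := pow_le_pow_left₀ hδ hq 2
  nlinarith [mul_le_mul_of_nonneg_left h1 (sub_nonneg.2 hθ1), mul_le_mul_of_nonneg_left h2 hθ0,
    sq_nonneg (θ - 1 / 2), sq_nonneg δ]

/-- **The drawing of a mesh edge between two white sites is disjoint from the black region**
(both colours present): a point of `[δw₁, δw₂]` is within `δ/2` of `δw₁` or of `δw₂`, and at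
distance `≥ (√3/2) δ` from every other site, in particular from its nearest black site. [folklore] -/
theorem not_mem_blackRegion_of_mem_segment {δ : ℝ} (hδ : 0 < δ) {ω : Set (Site 2)} (hω : ω.Nonempty)
    {w₁ w₂ : Site 2} (hw₁ : w₁ ∉ ω) (hw₂ : w₂ ∉ ω) (hw : triGraph.Adj w₁ w₂) {z : ℂ}
    (hz : z ∈ segment ℝ (triMeshPoint δ w₁) (triMeshPoint δ w₂)) :
    z ∉ blackRegion (triMeshPoint δ '' ω) (triMeshPoint δ '' ωᶜ) := by
  rw [mem_blackRegion, not_le]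
  obtain ⟨_, ⟨c, hc, rfl⟩, hdist⟩ := (isClosed_image_triMeshPoint hδ ω).exists_infDist_eq_dist (hω.image _) z
  rw [hdist]
  have hpq : dist (triMeshPoint δ w₁) (triMeshPoint δ w₂) = δ := by
    rw [dist_triMeshPoint_of_triGraph_adj hw, abs_of_pos hδ]
  have hc₁ : w₁ ≠ c := fun h => hw₁ (h ▸ hc)
  have hc₂ : w₂ ≠ c := fun h => hw₂ (h ▸ hc)
  have h34 := three_quarters_sq_le_dist_sq hpq (le_dist_triMeshPoint_of_ne hδ hc₁)
    (le_dist_triMeshPoint_of_ne hδ hc₂) hz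
  -- `z` is within `δ/2` of one of the two white ends
  have hsum : dist (triMeshPoint δ w₁) z + dist z (triMeshPoint δ w₂) = δ := by
    rw [(mem_segment_iff_wbtw.1 hz).dist_add_dist, hpq]
  have hW : infDist z (triMeshPoint δ '' ωᶜ) ≤ δ / 2 := by
    by_cases h : dist z (triMeshPoint δ w₁) ≤ δ / 2
    · exact (infDist_le_dist_of_mem (mem_image_of_mem _ hw₁)).trans h
    · refine (infDist_le_dist_of_mem (mem_image_of_mem _ hw₂)).trans ?_
      push Not at h
      rw [dist_comm] at h
      linarith
  have h0 : 0 ≤ infDist z (triMeshPoint δ '' ωᶜ) := infDist_nonneg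
  nlinarith [dist_nonneg (x := z) (y := triMeshPoint δ c)]

/-- Restricting the ambient set of a path to an invariant set (copy of the private helper of
`TriCrossingSandwich.lean`): if `a ∈ T` and `T` is closed under the steps of the path, the path
lies inside `S ∩ T`. [folklore] -/
theorem pathIn_inter_of_step_invariant {V : Type*} {H : SimpleGraph V} {S T : Set V} {a b : V}
    (h : PathIn H S a b) (ha : a ∈ T) (hT : ∀ p ∈ S, ∀ q ∈ S, p ∈ T → H.Adj p q → q ∈ T) :
    PathIn H (S ∩ T) a b := by
  obtain ⟨haS, hr⟩ := h
  refine ⟨⟨haS, ha⟩, ?_⟩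
  induction hr with
  | refl => exact Relation.ReflTransGen.refl
  | @tail p q hap hpq ih =>
    have hp : p ∈ S ∩ T := PathIn.right_mem (show PathIn H (S ∩ T) a p from ⟨⟨haS, ha⟩, ih⟩)
    exact ih.tail ⟨hpq.1, hpq.2, hT p hp.1 q hpq.2 hp.2 hpq.1⟩

/-- **Upper sandwich half for the continuum Voronoi crossing** (continuum analogue of
`not_mem_triCrossing_compl_of_pathIn`; Bollobás–Riordan 2006, Ch. 7, Claims 19–20 p. 192 with
the remark p. 195). For every conformal rectangle `R` there are `δ₀, t₀ > 0` such that for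
`0 < δ < δ₀`, `0 ≤ t ≤ t₀`: let `S` be a set of WHITE sites of a colouring `ω` with a black site,
every site of `S` off `Ω` being within `t` of `arc 1` or of `arc 3` and every site of `S` in `Ω`
farther than `δ` from `arc 0` and from `arc 2`, and let `u, v ∈ S` be off `Ω` within `t` of
`arc 1`, resp. `arc 3`.  If `S` contains a `𝕋`-path from `u` to `v`, then the black hexagons of
`ω` do NOT cross `closure Ω` from `arc 0` to `arc 2`: the run of the path strictly inside `Ω`
between its last step near `arc 1` and its first later step near `arc 3`, loop-erased and extended
by the two exit pieces, is a cross-cut of white mesh edges from `arc 1°` to `arc 3°`, which every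
continuum path in `closure Ω` from `arc 0` to `arc 2` must meet (Newman's cross-cut theorem,
`JordanDomain.inter_nonempty_of_crosscut`), while a black path cannot
(`not_mem_blackRegion_of_mem_segment`).  Unlike the G02 version no corner condition is needed.
[cite: BollobasRiordan2006, Ch. 7 Claims 19–20 p. 192 and remark p. 195] -/
theorem not_voronoiCrossing_of_pathIn (R : ConformalRectangle) :
    ∃ δ₀ > 0, ∃ t₀ > 0, ∀ δ t : ℝ, 0 < δ → δ < δ₀ → 0 ≤ t → t ≤ t₀ →
      ∀ (ω S : Set (Site 2)) (u v : Site 2), S ⊆ ωᶜ → ω.Nonempty →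
        (∀ x ∈ S, triMeshPoint δ x ∉ R.carrier →
          infDist (triMeshPoint δ x) (R.arc 1) ≤ t ∨ infDist (triMeshPoint δ x) (R.arc 3) ≤ t) →
        (∀ x ∈ S, triMeshPoint δ x ∈ R.carrier →
          δ < infDist (triMeshPoint δ x) (R.arc 0) ∧ δ < infDist (triMeshPoint δ x) (R.arc 2)) →
        triMeshPoint δ u ∉ R.carrier → infDist (triMeshPoint δ u) (R.arc 1) ≤ t →
        triMeshPoint δ v ∉ R.carrier → infDist (triMeshPoint δ v) (R.arc 3) ≤ t →
        PathIn triGraph S u v →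
        ¬ voronoiCrossing R.carrier (R.arc 0) (R.arc 2) δ (triEmbed '' ω) (triEmbed '' ωᶜ) := by
  classical
  obtain ⟨ε, hε, hεd⟩ := R.exists_pos_forall_lt_dist_arc_one_three
  obtain ⟨h0, h01, h12, h23, h3⟩ := mark_chain R
  refine ⟨ε / 8, by positivity, ε / 8, by positivity, ?_⟩
  intro δ t hδ hδlt ht htle ω S u v hSχ hω hout hin huΩ huA hvΩ hvB hP
  set χ : Set (Site 2) := ωᶜ with hχ
  set Ω := R.carrier with hΩ
  set A := R.arc 1 with hA
  set B := R.arc 3 with hB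
  have hΩo : IsOpen Ω := R.isOpen
  have hδabs : |δ| = δ := abs_of_pos hδ
  have hfr : frontier Ω ⊆ (A ∪ B) ∪ (R.arc 0 ∪ R.arc 2) := frontier_subset_arcs_one_three R
  have hfr' : frontier Ω ⊆ (B ∪ A) ∪ (R.arc 0 ∪ R.arc 2) := hfr.trans (by rw [union_comm A B])
  have hAne : A.Nonempty := ⟨_, R.pt_mem_arc_self 1⟩
  have hBne : B.Nonempty := ⟨_, R.pt_mem_arc_self 3⟩
  have hAB : ∀ p ∈ A, ∀ q ∈ B, 2 * t + 2 * δ < dist p q := fun p hp q hq => by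
    linarith [hεd p hp q hq]
  have hBA : ∀ p ∈ B, ∀ q ∈ A, 2 * t + 2 * δ < dist p q := fun p hp q hq => by
    rw [dist_comm]; exact hAB q hq p hp
  -- the three kinds of steps, with the strict inside graph
  set H := triStrictGraph Ω δ with hH
  have hHG : H ≤ triGraph := triStrictGraph_le_triGraph Ω δ
  have hHΩl : ∀ {p q : Site 2}, H.Adj p q → triMeshPoint δ p ∈ Ω := fun h =>
    (triStrictGraph_adj_iff.1 h).2 (left_mem_segment ℝ _ _)
  have hHΩr : ∀ {p q : Site 2}, H.Adj p q → triMeshPoint δ q ∈ Ω := fun h =>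
    (triStrictGraph_adj_iff.1 h).2 (right_mem_segment ℝ _ _)
  have hclass : ∀ a ∈ S, ∀ b ∈ S, triGraph.Adj a b →
      H.Adj a b ∨ NearOut Ω δ A t a b ∨ NearOut Ω δ B t a b := by
    intro a haS b _ hab
    rcases segment_subset_or_nearOut hΩo hfr hδ ht hab (hout a haS) (hin a haS) with h | h | h
    · exact Or.inl (triStrictGraph_adj_iff.2 ⟨hab, h⟩)
    · exact Or.inr (Or.inl h)
    · exact Or.inr (Or.inr h)
  have hu' : ∀ b ∈ S, triGraph.Adj u b → ¬ H.Adj u b ∧ NearOut Ω δ A t u b := fun b _ _ =>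
    ⟨fun h => huΩ (hHΩl h), NearOut.of_left huΩ huA⟩
  have hv' : ∀ a ∈ S, triGraph.Adj a v → ¬ H.Adj a v ∧ ¬ NearOut Ω δ A t a v := fun a _ hav =>
    ⟨fun h => hvΩ (hHΩr h),
      fun h => h.not_nearOut hδ hAne hBne hAB hav (NearOut.of_left hvΩ hvB).symm⟩
  have huv : u ≠ v := by
    rintro rfl
    obtain ⟨p, hp, hup⟩ := (infDist_lt_iff hAne).1 (show infDist (triMeshPoint δ u) A < t + δ by linarith)
    obtain ⟨q, hq, huq⟩ := (infDist_lt_iff hBne).1 (show infDist (triMeshPoint δ u) B < t + δ by linarith)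
    linarith [hAB p hp q hq, dist_triangle p (triMeshPoint δ u) q, dist_comm p (triMeshPoint δ u)]
  obtain ⟨a', a, b, b', ha'S, ha'a, -, hL0, hrun, hb'S, hbb', -, hnL0, hL2⟩ :=
    PathIn.exists_run (H := H) hHG hclass hu' hv' huv hP
  have haS : a ∈ S := hrun.left_mem
  have hbS : b ∈ S := hrun.right_mem
  -- the ends of the run are inside `Ω`
  have haΩ : triMeshPoint δ a ∈ Ω := by
    by_contra h
    rcases hout a haS h with h' | h'
    · by_cases hab : a = b
      · subst hab
        exact hnL0 (NearOut.of_left h h')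
      · obtain ⟨c, -, hac⟩ := hrun.exists_adj_head hab
        exact h (hHΩl hac)
    · exact hL0.not_nearOut hδ hAne hBne hAB ha'a (NearOut.of_left h h').symm
  have hbΩ : triMeshPoint δ b ∈ Ω := by
    by_contra h
    rcases hout b hbS h with h' | h'
    · exact hnL0 (NearOut.of_left h h')
    · by_cases hab : a = b
      · subst hab
        exact hL0.not_nearOut hδ hAne hBne hAB ha'a (NearOut.of_left h h').symm
      · obtain ⟨c, -, hcb⟩ := hrun.exists_adj_last hab
        exact h (hHΩr hcb)
  -- the exits at the two ends: points of `arc 1°`, `arc 3°`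
  obtain ⟨sa, fa, hsa0, hsa1, hfa, hfafr, hfaΩ, hfaA, hafa, hbeforea⟩ :=
    hL0.exists_exit hΩo hfr hAne hδ hAB ha'a haΩ (hin a haS haΩ)
  obtain ⟨sb, fb, hsb0, hsb1, hfb, hfbfr, hfbΩ, hfbB, hbfb, hbeforeb⟩ :=
    hL2.symm.exists_exit hΩo hfr' hBne hδ hBA hbb'.symm hbΩ (hin b hbS hbΩ)
  have hoff : ∀ {p : Site 2} {f : ℂ} (j : Fin 4), p ∈ S → triMeshPoint δ p ∈ Ω →
      dist (triMeshPoint δ p) f ≤ δ → (j = 0 ∨ j = 2) → f ∉ R.arc j := by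
    intro p f j hpS hpΩ hpf hj hf
    have h1 := infDist_le_dist_of_mem (x := triMeshPoint δ p) hf
    rcases hj with rfl | rfl
    · linarith [(hin p hpS hpΩ).1]
    · linarith [(hin p hpS hpΩ).2]
  obtain ⟨ss, hss, hfass⟩ := exists_mem_Ioo_of_mem_arc_one R hfaA
    (hoff 0 haS haΩ hafa (Or.inl rfl)) (hoff 2 haS haΩ hafa (Or.inr rfl))
  obtain ⟨tt, htt, hfbtt⟩ := exists_mem_Ioo_of_mem_arc_three R hfbB
    (hoff 2 hbS hbΩ hbfb (Or.inr rfl)) (hoff 0 hbS hbΩ hbfb (Or.inl rfl))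
  have hst : ss < tt := by linarith [hss.2, htt.1]
  have hts : tt < ss + 1 := by linarith [hss.1, htt.2]
  -- the strict run as a `𝕋`-path with mesh edges in `Ω`
  have hrunΩ : PathIn H (S ∩ {z | triMeshPoint δ z ∈ Ω}) a b :=
    pathIn_inter_of_step_invariant hrun haΩ fun p _ q _ _ hpq => hHΩr hpq
  obtain ⟨W, hW⟩ := hrunΩ.exists_walk
  set π : triGraph.Walk a b := W.bypass.mapLe hHG with hπ
  have hπs : ∀ z ∈ π.support, z ∈ χ := fun z hz => by
    rw [hπ, SimpleGraph.Walk.support_mapLe_eq_support] at hz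
    exact hSχ (hW z (W.support_bypass_subset_support hz)).1
  have hπgood : ∀ e ∈ π.edges, triEdgeSeg δ e ⊆ Ω := by
    intro e he
    rw [hπ, SimpleGraph.Walk.edges_mapLe_eq_edges] at he
    have he' := W.edges_bypass_subset_edges he
    revert he'
    induction e using Sym2.ind with
    | h p q =>
      intro he'
      rw [triEdgeSeg_mk]
      exact (triStrictGraph_adj_iff.1 (W.adj_of_mem_edges he')).2
  have hπpath : π.IsPath := (SimpleGraph.Walk.isPath_mapLe hHG).2 W.bypass_isPath
  -- `δa ≠ δb`: near `arc 1` and `arc 3` respectively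
  set Pa := triMeshPoint δ a with hPa
  set Pb := triMeshPoint δ b with hPb
  have hfafb : ε < dist fa fb := hεd fa hfaA fb hfbB
  have hPab : Pa ≠ Pb := by
    intro h
    have h1 : dist Pb fa ≤ δ := h ▸ hafa
    linarith [dist_triangle fa Pb fb, dist_comm fa Pb]
  have hπn : ¬ π.Nil := fun hn => hPab (by rw [hPa, hPb, hn.eq])
  -- the three arcs and their gluing
  have hTarc : IsSimpleArc (triWalkTrace δ π) Pa Pb := isSimpleArc_triWalkTrace hδ.ne' hπpath hπn
  have hAarc : IsSimpleArc (segment ℝ Pa fa) fa Pa := by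
    have := IsSimpleArc.subsegment (triMeshPoint_ne_of_adj hδ.ne' ha'a.symm) hsa0
    rw [← hfa] at this
    exact this.symm
  have hBarc : IsSimpleArc (segment ℝ Pb fb) Pb fb := by
    have := IsSimpleArc.subsegment (triMeshPoint_ne_of_adj hδ.ne' hbb') hsb0
    rw [← hfb] at this
    exact this
  have hfaseg : fa ∈ segment ℝ Pa (triMeshPoint δ a') := by rw [hfa]; exact add_smul_sub_mem_segment hsa0.le hsa1
  have hfbseg : fb ∈ segment ℝ Pb (triMeshPoint δ b') := by rw [hfb]; exact add_smul_sub_mem_segment hsb0.le hsb1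
  have h₁ : segment ℝ Pa fa ∩ triWalkTrace δ π ⊆ {Pa} :=
    segment_inter_triWalkTrace_subset hδ ha'a.symm hsa0 hsa1 hfa hfaΩ hπgood
  have h₂ : (segment ℝ Pa fa ∪ triWalkTrace δ π) ∩ segment ℝ Pb fb ⊆ {Pb} := by
    rintro z ⟨hz | hz, hz'⟩
    · -- the two exit pieces are far apart
      exfalso
      have h1 : dist z Pa ≤ δ := by
        have := dist_le_of_mem_subsegment_triMeshPoint ha'a.symm hfaseg hz; rwa [hδabs] at this
      have h2 : dist z Pb ≤ δ := by
        have := dist_le_of_mem_subsegment_triMeshPoint hbb' hfbseg hz'; rwa [hδabs] at this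
      linarith [dist_triangle4 fa Pa z Pb, dist_triangle fa Pb fb, dist_comm fa Pa, dist_comm Pa z]
    · have := segment_inter_triWalkTrace_subset hδ hbb' hsb0 hsb1 hfb hfbΩ (Q := π.reverse)
        (fun e he => hπgood e (by rwa [SimpleGraph.Walk.edges_reverse, List.mem_reverse] at he))
      refine this ⟨hz', ?_⟩
      rwa [triWalkTrace_reverse]
  have harc : IsSimpleArc ((segment ℝ Pa fa ∪ triWalkTrace δ π) ∪ segment ℝ Pb fb) fa fb :=
    (hAarc.union hTarc h₁).union hBarc h₂
  set Λ : Set ℂ := (segment ℝ Pa fa ∪ triWalkTrace δ π) ∪ segment ℝ Pb fb with hΛ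
  have hcross : R.IsCrosscut Λ (R.boundary ss) (R.boundary tt) := by
    refine ⟨?_, ?_, ?_, ?_, ?_⟩
    · rw [← hfass, ← hfbtt]; exact harc
    · rw [← hfass]; exact hfafr
    · rw [← hfbtt]; exact hfbfr
    · rw [← hfass, ← hfbtt]
      intro h
      rw [h, dist_self] at hfafb
      linarith
    · rw [← hfass, ← hfbtt]
      rintro z ⟨((hz | hz) | hz), hzne⟩
      · have hzf : z ≠ fa := fun h => hzne (Or.inl h)
        exact mem_of_mem_subsegment_of_ne hsa0 hfa hbeforea hz hzf
      · exact triWalkTrace_subset_of_edges hπgood hz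
      · have hzf : z ≠ fb := fun h => hzne (Or.inr h)
        exact mem_of_mem_subsegment_of_ne hsb0 hfb hbeforeb hz hzf
  -- `Λ` consists of white mesh edges: it misses the black region
  have hΛwhite : ∀ z ∈ Λ, z ∉ blackRegion (triMeshPoint δ '' ω) (triMeshPoint δ '' ωᶜ) := by
    have hwseg : ∀ {p q : Site 2} {z : ℂ}, p ∈ χ → q ∈ χ → triGraph.Adj p q →
        z ∈ segment ℝ (triMeshPoint δ p) (triMeshPoint δ q) →
        z ∉ blackRegion (triMeshPoint δ '' ω) (triMeshPoint δ '' ωᶜ) :=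
      fun hp hq hpq hz => not_mem_blackRegion_of_mem_segment hδ hω hp hq hpq hz
    rintro z ((hz | hz) | hz)
    · have hz' : z ∈ segment ℝ Pa (triMeshPoint δ a') := by
        rw [hfa] at hz; exact subsegment_subset hsa0.le hsa1 hz
      exact hwseg (hSχ haS) (hSχ ha'S) ha'a.symm hz'
    · obtain ⟨e, he, hze⟩ := mem_triWalkTrace_iff.1 hz
      revert he hze
      induction e using Sym2.ind with
      | h p q =>
        intro he hze
        rw [triEdgeSeg_mk] at hze
        exact hwseg (hπs p (π.fst_mem_support_of_mem_edges he))
          (hπs q (π.snd_mem_support_of_mem_edges he)) (π.adj_of_mem_edges he) hze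
    · have hz' : z ∈ segment ℝ Pb (triMeshPoint δ b') := by
        rw [hfb] at hz; exact subsegment_subset hsb0.le hsb1 hz
      exact hwseg (hSχ hbS) (hSχ hb'S) hbb' hz'
  -- a black continuum crossing would meet `Λ` (Newman's cross-cut theorem)
  intro hvc
  rw [voronoiCrossing_iff_smul hδ.ne', ← image_triMeshPoint_eq_smul, ← image_triMeshPoint_eq_smul] at hvc
  obtain ⟨x, hx, y, hy, hJ⟩ := hvc
  set γ := hJ.somePath with hγ
  set P : Set ℂ := range γ with hPdef
  have hγmem := hJ.somePath_mem
  have hPpre : IsPreconnected P := (isConnected_range γ.continuous).isPreconnected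
  have hPcl : P ⊆ closure Ω := by
    rintro _ ⟨τ, rfl⟩; exact (hγmem τ).1
  have hxP : x ∈ P := ⟨0, γ.source⟩
  have hyP : y ∈ P := ⟨1, γ.target⟩
  -- parameters of the end-points: `x ∈ arc 0` beyond `tt`, `y ∈ arc 2` between `ss` and `tt`
  obtain ⟨u₀, hu₀, hxu₀⟩ := hx
  obtain ⟨u₂, hu₂, hyu₂⟩ := hy
  have hn0 : R.nextMark 0 = R.mark 1 := rfl
  have hn2 : R.nextMark 2 = R.mark 3 := rfl
  rw [hn0] at hu₀
  rw [hn2] at hu₂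
  have hx' : R.boundary (u₀ + 1) ∈ P := by rw [R.periodic_boundary, hxu₀]; exact hxP
  have hy' : R.boundary u₂ ∈ P := by rw [hyu₂]; exact hyP
  have hu₀' : u₀ + 1 ∈ Ioo tt (ss + 1) := ⟨by linarith [htt.2, hu₀.1], by linarith [hss.1, hu₀.2]⟩
  have hu₂' : u₂ ∈ Ioo ss tt := ⟨by linarith [hss.2, hu₂.1], by linarith [htt.1, hu₂.2]⟩
  obtain ⟨z, hzP, hzΛ⟩ := R.toJordanDomain.inter_nonempty_of_crosscut Newman1939_crosscut_holds
    hst hts hcross hPpre hPcl hu₂' hy' hu₀' hx'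
  obtain ⟨τ, rfl⟩ := hzP
  exact hΛwhite _ hzΛ (hγmem τ).2

/-- The all-white colouring is a null event of fair site percolation on the lattice: `ω ↦ ωᶜ`
preserves `P_{1/2}` (`sitePercolation_real_preimage_compl`) and `{∅} = compl ⁻¹' {univ}`. [folklore] -/
theorem sitePercolation_half_real_empty :
    (sitePercolation (Site 2) half).real {(∅ : Set (Site 2))} = 0 := by
  have h : ({(∅ : Set (Site 2))} : Set (Set (Site 2))) = compl ⁻¹' {(univ : Set (Site 2))} := by
    ext ω
    simp only [mem_singleton_iff, mem_preimage, Set.compl_univ_iff]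
  rw [h, sitePercolation_real_preimage_compl, symm_half, sitePercolation_half_real_univ]

/-- **Upper half of (19) for the continuum event, probability form** (continuum analogue of
`triCrossingProb_le_real_not_pathIn`, without corner condition): for all small `δ` and `t`, if `V`
is a set of sites whose members off `Ω` are within `t` of `arc 1 ∪ arc 3` and whose members in
`Ω` are farther than `δ` from `arc 0 ∪ arc 2`, and `U₁`, `U₃` are sets of sites off `Ω` within `t`
of `arc 1`, `arc 3` respectively, then the `P_{1/2}`-probability of the continuum Voronoi crossing
of `closure Ω` from `arc 0` to `arc 2` by the black hexagons is at most the probability that there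
is **no** closed `𝕋`-path inside `V` from `U₁` to `U₃` (the all-closed colouring is null).
[cite: BollobasRiordan2006, Ch. 7 Claim 20 p. 192 and remark p. 195] -/
theorem real_voronoiCrossing_le_real_not_pathIn (R : ConformalRectangle) :
    ∃ δ₀ > 0, ∃ t₀ > 0, ∀ δ t : ℝ, 0 < δ → δ < δ₀ → 0 ≤ t → t ≤ t₀ →
      ∀ (V U₁ U₃ : Set (Site 2)),
        (∀ x ∈ V, triMeshPoint δ x ∉ R.carrier →
          infDist (triMeshPoint δ x) (R.arc 1) ≤ t ∨ infDist (triMeshPoint δ x) (R.arc 3) ≤ t) →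
        (∀ x ∈ V, triMeshPoint δ x ∈ R.carrier →
          δ < infDist (triMeshPoint δ x) (R.arc 0) ∧ δ < infDist (triMeshPoint δ x) (R.arc 2)) →
        (∀ u ∈ U₁, triMeshPoint δ u ∉ R.carrier ∧ infDist (triMeshPoint δ u) (R.arc 1) ≤ t) →
        (∀ v ∈ U₃, triMeshPoint δ v ∉ R.carrier ∧ infDist (triMeshPoint δ v) (R.arc 3) ≤ t) →
        (sitePercolation (Site 2) half).real
            {ω | voronoiCrossing R.carrier (R.arc 0) (R.arc 2) δ (triEmbed '' ω) (triEmbed '' ωᶜ)} ≤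
          (sitePercolation (Site 2) half).real
            {ω | ¬ ∃ u ∈ U₁, ∃ v ∈ U₃, PathIn triGraph (V ∩ ωᶜ) u v} := by
  obtain ⟨δ₀, hδ₀, t₀, ht₀, h⟩ := not_voronoiCrossing_of_pathIn R
  refine ⟨δ₀, hδ₀, t₀, ht₀, fun δ t hδ hδlt ht htle V U₁ U₃ hout hin hU₁ hU₃ => ?_⟩
  set μ := sitePercolation (Site 2) half with hμ
  set C := {ω : Set (Site 2) |
    voronoiCrossing R.carrier (R.arc 0) (R.arc 2) δ (triEmbed '' ω) (triEmbed '' ωᶜ)} with hC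
  set N := {ω : Set (Site 2) | ¬ ∃ u ∈ U₁, ∃ v ∈ U₃, PathIn triGraph (V ∩ ωᶜ) u v} with hN
  have hsub : C ⊆ N ∪ {(∅ : Set (Site 2))} := by
    intro ω hω
    by_cases hωe : ω = ∅
    · exact Or.inr hωe
    · refine Or.inl ?_
      rintro ⟨u, hu, v, hv, hP⟩
      exact h δ t hδ hδlt ht htle ω (V ∩ ωᶜ) u v inter_subset_right (nonempty_iff_ne_empty.2 hωe)
        (fun x hx => hout x hx.1) (fun x hx => hin x hx.1) (hU₁ u hu).1 (hU₁ u hu).2 (hU₃ v hv).1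
        (hU₃ v hv).2 hP hω
  calc μ.real C ≤ μ.real (N ∪ {(∅ : Set (Site 2))}) := measureReal_mono hsub (measure_ne_top _ _)
    _ ≤ μ.real N + μ.real {(∅ : Set (Site 2))} := measureReal_union_le _ _
    _ = μ.real N := by rw [hμ, sitePercolation_half_real_empty, add_zero]

end Summit.CriticalPhenomena.CardyFormulaZ2.Theorems

end
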